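import Mathlib
import HarnessLib
import Summits.ValiantsHypothesis.ValiantsHypothesis.Theses.MonotoneRestoration
import Literature.Computability.AlgebraicComplexity.ArithCircuit
import Literature.Computability.AlgebraicComplexity.ArithCircuitProofs
import Literature.Computability.AlgebraicComplexity.MonotoneStructure
import Literature.Computability.AlgebraicComplexity.PermanentIrreducible
import Literature.ModelTheory.FiniteModelTheory.CkEquiv
import Summits.ValiantsHypothesis.ValiantsHypothesis.Theorems.MonotoneRestorationMonotoneRestorationQPCosetCount
import Summits.ValiantsHypothesis.ValiantsHypothesis.Theorems.MonotoneRestorationMonotoneRestorationQPSymmetricLB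
import Summits.ValiantsHypothesis.ValiantsHypothesis.Theorems.MonotoneRestorationMonotoneRestorationQPSupportSymmetrisation
import Summits.ValiantsHypothesis.ValiantsHypothesis.Theorems.MonotoneRestorationMonotoneRestorationQPSparseRegime
import Summits.ValiantsHypothesis.ValiantsHypothesis.Theorems.MonotoneRestorationMonotoneRestorationQPBeta
import Literature.Computability.AlgebraicComplexity.SymmetricArithCircuit
import Literature.Computability.AlgebraicComplexity.DawarWilsenach2025Proofs
import Literature.GroupTheory.PermutationGroups.SmallIndexSubgroups
import Summits.ValiantsHypothesis.ValiantsHypothesis.Theorems.MonotoneRestorationQP.Negative.LoadBearing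
import Summits.ValiantsHypothesis.ValiantsHypothesis.Theorems.MonotoneRestorationMonotoneRestorationQPPermSupportCount

/-! TTRL-lite variant V19237 of stmt-ValiantsHypothesis-15886 -/

-- `Summit.ValiantsHypothesis.ValiantsHypothesis.…` is the tree's mandated single-conjunct layout
-- (Sub = Summit), so the duplicated namespace component is intended.
set_option linter.dupNamespace false

namespace Summit.ValiantsHypothesis.ValiantsHypothesis.Theorems

open Summit.ValiantsHypothesis.ValiantsHypothesis.Theses.MonotoneRestoration
open Literature.Computability.AlgebraicComplexity

/-- Row sums are cheap: the `i`-th row sum `∑ⱼ X (i, j)` of the generic `n × n` matrix has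
monotone (semiring `ℝ≥0`) circuit complexity at most `n` — variables are free and one addition
gate per summand suffices (TTRL-lite variant V19237 of stmt-ValiantsHypothesis-15886). -/
theorem stub_eSymmRowSums_comp_var19237 :
    ∀ (n : ℕ) (i : Fin n), complexity (∑ j : Fin n,
      (MvPolynomial.X (i, j) : MvPolynomial (Fin n × Fin n) NNReal)) ≤ n := by
  intro n i
  refine (complexity_finset_sum_le _ _).trans ?_
  have h0 : ∀ j ∈ (Finset.univ : Finset (Fin n)),
      complexity (MvPolynomial.X (i, j) : MvPolynomial (Fin n × Fin n) NNReal) = 0 :=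
    fun j _ => complexity_X_holds _
  rw [Finset.sum_eq_zero h0, zero_add, Finset.card_univ, Fintype.card_fin]

end Summit.ValiantsHypothesis.ValiantsHypothesis.Theorems
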